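import Summits.AnomalousDissipation.AnomalousDissipation.Theses.TwoAndHalfD
import Literature.Analysis.FluidPDE.TwoHalfNavierStokes
import Literature.Analysis.FluidPDE.PassiveScalarForced
import Literature.Analysis.FluidPDE.EulerSymmetricGradient
import Literature.Analysis.FunctionSpaces.TorusEnstrophyOrthogonality
import Literature.Analysis.FunctionSpaces.TorusTrigPoly
import Literature.Analysis.FunctionSpaces.TorusScalarTrigPoly
import Literature.Analysis.FunctionSpaces.TorusConvolution

/-!
# The Navier–Stokes nonlinearity against a perpendicular gradient (stub stub_weakVorticityNonlinear of the line `log-kantorovich-enstrophy-transfer`, crux `TwoAndHalfD.TwohalfdNeg`, stmt-AnomalousDissipation-0211)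

For `w ∈ L²(𝕋²; ℝ²)` weakly divergence free, `ω ∈ L²(𝕋²)` a weak curl of `w`
(`∫ (∂₀χ·w₁ - ∂₁χ·w₀) = -∫ χ ω` for smooth `χ`), a smooth `φ` and `ψ = ∇^⊥φ = (-∂₁φ, ∂₀φ)`:
`∫ ⟪w, (w·∇)ψ⟫ = -∫ ω ⟪w, ∇φ⟫` — the weak, one-time-slice form of the planar identity
`(w·∇)w = ∇(|w|²/2) + ω w^⊥` behind the vorticity formulation of 2-D Navier–Stokes
(Majda–Bertozzi 2002, §2.1). Proof:
* smooth divergence-free `u` (`integral_inner_convect_perpGrad_eq`): the transport identity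
  `∫ D⟪u,ψ⟫[u] = 0` gives `∫⟪u,(u·∇)ψ⟫ = -∫⟪(u·∇)u, ψ⟫`; pointwise
  `⟪Du a, b⟫ - ⟪a, Du b⟫ = (curl u)(a₀b₁ - a₁b₀)` and `u₀ψ₁ - u₁ψ₀ = ⟪u, ∇φ⟫`, while
  `∫⟪u, Du ψ⟫ = ½∫ D|u|²[ψ] = 0` (transport along the divergence-free `ψ`);
* general `w`: the Fourier truncations `P_N w` (`Torus.fourierTruncate`) are smooth, divergence free
  and `→ w` in `L²`; `ω̂(k) = 2πi(k₀ŵ₁ - k₁ŵ₀)` (`mFourierCoeff_ofReal_eq_of_weakCurl`, testing the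
  weak curl with `Re (z e_{-k})`), hence `curl P_N w = P_N ω → ω` in `L²` (Parseval), and both sides
  pass to the limit by continuity of the `L²` pairing under bounded continuous multipliers.
The `H¹` hypothesis of the registered signature is not used.
-/

namespace Summit.AnomalousDissipation.AnomalousDissipation.Theorems.TwohalfdNeg.WeakVorticityNonlinear

open MeasureTheory Filter Topology
open scoped ENNReal NNReal
open Literature.Analysis.FunctionSpaces Literature.Analysis.FluidPDE

set_option linter.dupNamespace false

open scoped InnerProductSpace

section Helpers

open UnitAddTorus Literature.Analysis.FunctionSpaces.Torus

/-! ## The smooth identity -/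

/-- **The antisymmetric part of a planar Jacobian is the vorticity**: for a `C¹` field `u` on
`𝕋²` and vectors `a, b ∈ ℝ²`, `⟪Du(x) a, b⟫ - ⟪a, Du(x) b⟫ = curl u (x) · (a₀ b₁ - a₁ b₀)` with
`curl u = ∂₀u₁ - ∂₁u₀`. -/
theorem inner_fderiv_apply_sub_inner_fderiv_apply_eq_curl_mul
    {u : UnitAddTorus (Fin 2) → EuclideanSpace ℝ (Fin 2)} (hu : Torus.IsContDiff 1 u)
    (x : UnitAddTorus (Fin 2)) (a b : EuclideanSpace ℝ (Fin 2)) :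
    ⟪Torus.fderiv u x a, b⟫_ℝ - ⟪a, Torus.fderiv u x b⟫_ℝ =
      (Torus.partialDeriv 0 (fun y => u y 1) x - Torus.partialDeriv 1 (fun y => u y 0) x) *
        (a 0 * b 1 - a 1 * b 0) := by
  rw [fderiv_apply_eq_sum_partialDeriv hu, fderiv_apply_eq_sum_partialDeriv hu,
    partialDeriv_apply_coord hu, partialDeriv_apply_coord hu]
  simp only [Fin.sum_univ_two, EuclideanSpace.inner_eq_star_dotProduct, star_trivial, dotProduct,
    WithLp.ofLp_add, WithLp.ofLp_smul, Pi.add_apply, Pi.smul_apply, smul_eq_mul, Fin.isValue]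
  ring

/-- The perpendicular gradient `∇^⊥φ = (-∂₁φ, ∂₀φ)` of a smooth scalar on `𝕋²` is smooth. -/
theorem isSmooth_of_eq_perpGrad {φ : UnitAddTorus (Fin 2) → ℝ}
    {ψ : UnitAddTorus (Fin 2) → EuclideanSpace ℝ (Fin 2)} (hφ : Torus.IsSmooth φ)
    (h0 : ∀ x, ψ x 0 = -Torus.partialDeriv 1 φ x) (h1 : ∀ x, ψ x 1 = Torus.partialDeriv 0 φ x) :
    Torus.IsSmooth ψ := by
  unfold Torus.IsSmooth
  rw [contDiff_euclidean]
  intro i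
  fin_cases i
  · have h : (fun y => Torus.lift ψ y 0) = fun y => -Torus.lift (Torus.partialDeriv 1 φ) y := by
      funext y; simp [Torus.lift_apply, h0]
    simp only [Fin.zero_eta, Fin.isValue]
    rw [h]
    exact (hφ.partialDeriv 1).neg
  · have h : (fun y => Torus.lift ψ y 1) = Torus.lift (Torus.partialDeriv 0 φ) := by
      funext y; simp [Torus.lift_apply, h1]
    simp only [Fin.mk_one, Fin.isValue]
    rw [h]
    exact hφ.partialDeriv 0

/-- The perpendicular gradient `∇^⊥φ = (-∂₁φ, ∂₀φ)` of a smooth scalar on `𝕋²` is divergence free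
(`div ∇^⊥φ = -∂₀∂₁φ + ∂₁∂₀φ = 0`, Schwarz). -/
theorem isDivFree_of_eq_perpGrad {φ : UnitAddTorus (Fin 2) → ℝ}
    {ψ : UnitAddTorus (Fin 2) → EuclideanSpace ℝ (Fin 2)} (hφ : Torus.IsSmooth φ)
    (h0 : ∀ x, ψ x 0 = -Torus.partialDeriv 1 φ x) (h1 : ∀ x, ψ x 1 = Torus.partialDeriv 0 φ x) :
    Torus.IsDivFree ψ := by
  intro x
  have e0 : (fun y => ψ y 0) = fun y => -Torus.partialDeriv 1 φ y := funext h0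
  have e1 : (fun y => ψ y 1) = Torus.partialDeriv 0 φ := funext h1
  rw [Torus.divergence, Fin.sum_univ_two, e0, e1, partialDeriv_neg, partialDeriv_comm hφ 0 1 x,
    neg_add_cancel]

/-- **The Navier–Stokes nonlinearity against a perpendicular gradient, smooth case.** For a smooth
divergence-free field `u` on `𝕋²`, a smooth scalar `φ` and `ψ = ∇^⊥φ = (-∂₁φ, ∂₀φ)`:
`∫ ⟪u, (u·∇)ψ⟫ = -∫ (curl u) ⟪u, ∇φ⟫`, `curl u = ∂₀u₁ - ∂₁u₀` — the weak form of the planar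
identity `(u·∇)u = ∇(|u|²/2) + (curl u) u^⊥`. Proof: the transport identity `∫ D⟪u,ψ⟫[u] = 0`
(`div u = 0`) gives `∫⟪u,(u·∇)ψ⟫ = -∫⟪(u·∇)u, ψ⟫`; pointwise
`⟪Du a, b⟫ - ⟪a, Du b⟫ = (curl u)(a₀b₁ - a₁b₀)` with `a = u`, `b = ψ`, where
`u₀ψ₁ - u₁ψ₀ = ⟪u, ∇φ⟫`, and `∫ ⟪u, Du ψ⟫ = ½ ∫ D|u|²[ψ] = 0` by the transport identity for the
divergence-free `ψ` (Majda–Bertozzi 2002, §2.1, the 2-D vorticity–stream formulation). -/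
theorem integral_inner_convect_perpGrad_eq {u : UnitAddTorus (Fin 2) → EuclideanSpace ℝ (Fin 2)}
    {φ : UnitAddTorus (Fin 2) → ℝ} {ψ : UnitAddTorus (Fin 2) → EuclideanSpace ℝ (Fin 2)}
    (hu : Torus.IsSmooth u) (hdiv : Torus.IsDivFree u) (hφ : Torus.IsSmooth φ)
    (h0 : ∀ x, ψ x 0 = -Torus.partialDeriv 1 φ x) (h1 : ∀ x, ψ x 1 = Torus.partialDeriv 0 φ x) :
    ∫ x, ⟪u x, Torus.convect u ψ x⟫_ℝ =
      -∫ x, (Torus.partialDeriv 0 (fun y => u y 1) x - Torus.partialDeriv 1 (fun y => u y 0) x) *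
        ⟪u x, Torus.gradient φ x⟫_ℝ := by
  have hψ : Torus.IsSmooth ψ := isSmooth_of_eq_perpGrad hφ h0 h1
  have hψdiv : Torus.IsDivFree ψ := isDivFree_of_eq_perpGrad hφ h0 h1
  have hu1 : Torus.IsContDiff 1 u := hu.isContDiff (by simp)
  have hψ1 : Torus.IsContDiff 1 ψ := hψ.isContDiff (by simp)
  have hφ1 : Torus.IsContDiff 1 φ := hφ.isContDiff (by simp)
  -- transport of `⟪u, ψ⟫` along `u` and of `‖u‖²` along `ψ`
  have hT1 := integral_fderiv_apply_eq_zero_of_isDivFree hu (hu.inner hψ) hdiv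
  simp_rw [fderiv_inner_apply hu1 hψ1] at hT1
  have hT2 := integral_fderiv_apply_eq_zero_of_isDivFree hψ hu.norm_sq hψdiv
  simp_rw [fderiv_norm_sq_apply hu1] at hT2
  -- the pointwise identity
  have hpt : ∀ x, ⟪Torus.fderiv u x (u x), ψ x⟫_ℝ =
      (Torus.partialDeriv 0 (fun y => u y 1) x - Torus.partialDeriv 1 (fun y => u y 0) x) *
          ⟪u x, Torus.gradient φ x⟫_ℝ + ⟪u x, Torus.fderiv u x (ψ x)⟫_ℝ := by
    intro x
    have h := inner_fderiv_apply_sub_inner_fderiv_apply_eq_curl_mul hu1 x (u x) (ψ x)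
    have hg : ⟪u x, Torus.gradient φ x⟫_ℝ = u x 0 * ψ x 1 - u x 1 * ψ x 0 := by
      rw [inner_gradient_eq_sum_mul_partialDeriv hφ1, Fin.sum_univ_two, h0, h1]; ring
    rw [hg]
    linarith
  -- integrability of the four smooth integrands
  have hI1 : Integrable (fun x => ⟪u x, Torus.fderiv ψ x (u x)⟫_ℝ) volume :=
    (hu.inner (hu.convect hψ)).integrable
  have hI2 : Integrable (fun x => ⟪Torus.fderiv u x (u x), ψ x⟫_ℝ) volume :=
    ((hu.convect hu).inner hψ).integrable
  have hcurl : Torus.IsSmooth (fun x =>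
      Torus.partialDeriv 0 (fun y => u y 1) x - Torus.partialDeriv 1 (fun y => u y 0) x) :=
    ((hu.apply 1).partialDeriv 0).sub ((hu.apply 0).partialDeriv 1)
  have hI3s : Torus.IsSmooth (fun x =>
      (Torus.partialDeriv 0 (fun y => u y 1) x - Torus.partialDeriv 1 (fun y => u y 0) x) *
        ⟪u x, Torus.gradient φ x⟫_ℝ) := hcurl.mul (hu.inner hφ.gradient)
  have hI3 := hI3s.integrable
  have hI4 : Integrable (fun x => ⟪u x, Torus.fderiv u x (ψ x)⟫_ℝ) volume :=
    (hu.inner (hψ.convect hu)).integrable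
  rw [integral_add hI1 hI2] at hT1
  rw [integral_const_mul] at hT2
  have h4 : ∫ x, ⟪u x, Torus.fderiv u x (ψ x)⟫_ℝ = 0 := by linarith
  have h2 : ∫ x, ⟪Torus.fderiv u x (u x), ψ x⟫_ℝ =
      ∫ x, (Torus.partialDeriv 0 (fun y => u y 1) x - Torus.partialDeriv 1 (fun y => u y 0) x) *
        ⟪u x, Torus.gradient φ x⟫_ℝ := by
    simp_rw [hpt]
    rw [integral_add hI3 hI4, h4, add_zero]
  show ∫ x, ⟪u x, Torus.fderiv ψ x (u x)⟫_ℝ = _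
  linarith

/-! ## The weak curl and the Fourier truncations -/

/-- **Fourier coefficients of a weak curl.** If `ω ∈ L¹(𝕋²)` is a weak curl of the field
`w ∈ L¹(𝕋²; ℝ²)`, i.e. `∫ (∂₀χ·w₁ - ∂₁χ·w₀) = -∫ χ ω` for every smooth real `χ`, then
`ω̂(k) = 2πi (k₀ ŵ₁(k) - k₁ ŵ₀(k))`, `ŵ = 𝓕(complexify ∘ w)`: test with the smooth real functions
`χ = Re (z e_{-k})`, `z = 1, i`, whose partial derivatives are `Re (-2πi kⱼ z e_{-k})` (the torus
form of Evans 2010, §5.8 Thm. 8, step 1; cf. `Torus.mFourierCoeff_eq_of_hasWeakPartialDeriv`). -/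
theorem mFourierCoeff_ofReal_eq_of_weakCurl {w : UnitAddTorus (Fin 2) → EuclideanSpace ℝ (Fin 2)}
    {ω : UnitAddTorus (Fin 2) → ℝ} (hw : Integrable w volume) (hω : Integrable ω volume)
    (hcurl : ∀ χ : UnitAddTorus (Fin 2) → ℝ, Torus.IsSmooth χ →
      ∫ x, (Torus.partialDeriv 0 χ x * w x 1 - Torus.partialDeriv 1 χ x * w x 0) = -∫ x, χ x * ω x)
    (k : Fin 2 → ℤ) :
    mFourierCoeff (fun x => (ω x : ℂ)) k =
      2 * Real.pi * Complex.I *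
        ((k 0 : ℂ) * mFourierCoeff (EuclideanSpace.complexify ∘ w) k 1 -
          (k 1 : ℂ) * mFourierCoeff (EuclideanSpace.complexify ∘ w) k 0) := by
  set Ω : ℂ := mFourierCoeff (fun x => (ω x : ℂ)) k with hΩ
  set Z : ℂ := (k 0 : ℂ) * mFourierCoeff (EuclideanSpace.complexify ∘ w) k 1 -
    (k 1 : ℂ) * mFourierCoeff (EuclideanSpace.complexify ∘ w) k 0 with hZ
  -- integrability of the coordinates against the character `e_{-k}`
  have hbd : ∀ x, ‖mFourier (-k) x‖ ≤ 1 := fun x =>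
    ((mFourier (-k)).norm_coe_le_norm x).trans_eq mFourier_norm
  have hmeas : AEStronglyMeasurable (⇑(mFourier (-k)) : UnitAddTorus (Fin 2) → ℂ) volume :=
    (mFourier (-k)).continuous.aestronglyMeasurable
  have hIw : ∀ j : Fin 2, Integrable (fun x => mFourier (-k) x * (w x j : ℂ)) volume := fun j =>
    (Complex.ofRealCLM.integrable_comp (hw.eval_piLp j)).bdd_mul hmeas (Eventually.of_forall hbd)
  have hIω : Integrable (fun x => mFourier (-k) x * (ω x : ℂ)) volume :=
    hω.ofReal.bdd_mul hmeas (Eventually.of_forall hbd)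
  have hΩint : ∫ x, mFourier (-k) x * (ω x : ℂ) = Ω := by
    rw [hΩ, mFourierCoeff_eq_integral_volume]; rfl
  -- the pairing with `χ_z = Re (z e_{-k})` computes `Re (z (Ω - 2πi Z)) = 0`
  have key : ∀ z : ℂ, (z * (Ω - 2 * Real.pi * Complex.I * Z)).re = 0 := by
    intro z
    set c : (Fin 2 → ℤ) → ℂ := fun _ => z with hc_def
    have hθ : Torus.IsSmooth (fun x : UnitAddTorus (Fin 2) => (trigPoly {-k} c x).re) :=
      isSmooth_re_trigPoly _ _
    have h0 := hcurl _ hθ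
    have hdj : ∀ (j : Fin 2) (x : UnitAddTorus (Fin 2)),
        Torus.partialDeriv j (fun y : UnitAddTorus (Fin 2) => (trigPoly {-k} c y).re) x =
          (mFourier (-k) x * (-(2 * Real.pi * Complex.I) * (k j) * z)).re := by
      intro j x
      rw [partialDeriv_re_trigPoly, trigPoly_apply, Finset.sum_singleton]
      simp only [hc_def, Pi.neg_apply, Int.cast_neg, smul_eq_mul]
      congr 1
      ring
    have hval : ∀ x : UnitAddTorus (Fin 2), (trigPoly {-k} c x).re = (mFourier (-k) x * z).re := by
      intro x
      rw [trigPoly_apply, Finset.sum_singleton, smul_eq_mul]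
    simp_rw [hdj, hval] at h0
    have hL : ∀ x : UnitAddTorus (Fin 2),
        (mFourier (-k) x * (-(2 * Real.pi * Complex.I) * (k 0) * z)).re * w x 1 -
          (mFourier (-k) x * (-(2 * Real.pi * Complex.I) * (k 1) * z)).re * w x 0 =
        (mFourier (-k) x * (w x 1 : ℂ) * (-(2 * Real.pi * Complex.I) * (k 0) * z) -
          mFourier (-k) x * (w x 0 : ℂ) * (-(2 * Real.pi * Complex.I) * (k 1) * z)).re := by
      intro x
      rw [← Complex.re_mul_ofReal, ← Complex.re_mul_ofReal, Complex.sub_re]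
      congr 1 <;> (congr 1; ring)
    have hR : ∀ x : UnitAddTorus (Fin 2),
        (mFourier (-k) x * z).re * ω x = (mFourier (-k) x * (ω x : ℂ) * z).re := by
      intro x
      rw [← Complex.re_mul_ofReal]
      congr 1; ring
    simp_rw [hL, hR] at h0
    have hI1 := (hIw 1).mul_const (-(2 * Real.pi * Complex.I) * (k 0) * z)
    have hI2 := (hIw 0).mul_const (-(2 * Real.pi * Complex.I) * (k 1) * z)
    have hI3 := hIω.mul_const z
    have hI12 : Integrable (fun x =>
        mFourier (-k) x * (w x 1 : ℂ) * (-(2 * Real.pi * Complex.I) * (k 0) * z) -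
          mFourier (-k) x * (w x 0 : ℂ) * (-(2 * Real.pi * Complex.I) * (k 1) * z)) volume :=
      hI1.sub hI2
    have hre1 := integral_re hI12
    have hre2 := integral_re hI3
    simp only [RCLike.re_to_complex] at hre1 hre2
    rw [hre1, hre2, integral_sub hI1 hI2, integral_mul_const, integral_mul_const,
      integral_mul_const, integral_mFourier_neg_mul_coord hw k 1,
      integral_mFourier_neg_mul_coord hw k 0, hΩint] at h0
    have e : z * (Ω - 2 * Real.pi * Complex.I * Z) =
        (mFourierCoeff (EuclideanSpace.complexify ∘ w) k 1 *
            (-(2 * Real.pi * Complex.I) * (k 0) * z) -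
          mFourierCoeff (EuclideanSpace.complexify ∘ w) k 0 *
            (-(2 * Real.pi * Complex.I) * (k 1) * z)) + Ω * z := by
      rw [hZ]; ring
    rw [e, Complex.add_re, h0, neg_add_cancel]
  -- `z = 1` and `z = i` give the real and imaginary parts
  have h1 := key 1
  have h2 := key Complex.I
  rw [one_mul] at h1
  rw [Complex.I_mul_re, neg_eq_zero] at h2
  exact sub_eq_zero.1 (Complex.ext h1 h2)

/-- **The curl of a Fourier truncation is the truncation of the weak curl**: if `ω ∈ L¹(𝕋²)` is
a weak curl of `w ∈ L¹(𝕋²; ℝ²)` then `curl (P_N w) = P_N ω` pointwise, `P_N` the Fourier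
truncations `Torus.fourierTruncate` / `Torus.scalarTruncate` (both sides are the real
trigonometric polynomial with coefficients `2πi (k₀ ŵ₁(k) - k₁ ŵ₀(k)) = ω̂(k)` on the ball). -/
theorem curl_fourierTruncate_eq_scalarTruncate {w : UnitAddTorus (Fin 2) → EuclideanSpace ℝ (Fin 2)}
    {ω : UnitAddTorus (Fin 2) → ℝ} (hw : Integrable w volume) (hω : Integrable ω volume)
    (hcurl : ∀ χ : UnitAddTorus (Fin 2) → ℝ, Torus.IsSmooth χ →
      ∫ x, (Torus.partialDeriv 0 χ x * w x 1 - Torus.partialDeriv 1 χ x * w x 0) = -∫ x, χ x * ω x)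
    (N : ℕ) (x : UnitAddTorus (Fin 2)) :
    Torus.partialDeriv 0 (fun y => Torus.fourierTruncate N w y 1) x -
        Torus.partialDeriv 1 (fun y => Torus.fourierTruncate N w y 0) x =
      Torus.scalarTruncate N ω x := by
  rw [fourierTruncate_eq, partialDeriv_realTrigPoly_coord, partialDeriv_realTrigPoly_coord,
    trigPoly_apply_coord, trigPoly_apply_coord, Torus.scalarTruncate, reTrigPoly_eq_sum,
    ← Complex.sub_re, ← Finset.sum_sub_distrib, Complex.re_sum]
  refine Finset.sum_congr rfl fun k _ => ?_
  rw [mFourierCoeff_ofReal_eq_of_weakCurl hw hω hcurl k]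
  simp only [PiLp.smul_apply, smul_eq_mul]
  congr 1
  ring

/-- **`P_N θ → θ` in `L²(𝕋²)`** for a real scalar `θ ∈ L²`, in `eLpNorm` form (the Parseval tail
`∫ (θ - P_N θ)² → 0`, `Torus.tendsto_integral_sq_sub_scalarTruncate`). -/
theorem tendsto_eLpNorm_scalarTruncate_sub {θ : UnitAddTorus (Fin 2) → ℝ} (hθ : MemLp θ 2 volume) :
    Tendsto (fun N => eLpNorm (Torus.scalarTruncate N θ - θ) 2 volume) atTop (𝓝 0) := by
  have h := tendsto_integral_sq_sub_scalarTruncate hθ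
  have e : ∀ N, eLpNorm (Torus.scalarTruncate N θ - θ) 2 volume =
      ENNReal.ofReal ((∫ x, (θ x - Torus.scalarTruncate N θ x) ^ 2) ^ (2 : ℝ)⁻¹) := by
    intro N
    have hm : MemLp (Torus.scalarTruncate N θ - θ) 2 volume := (memLp_scalarTruncate N θ 2).sub hθ
    rw [hm.eLpNorm_eq_integral_rpow_norm two_ne_zero ENNReal.ofNat_ne_top, ENNReal.toReal_ofNat]
    congr 2
    refine integral_congr_ae (ae_of_all _ fun x => ?_)
    simp only [Pi.sub_apply, Real.norm_eq_abs, Real.rpow_two, sq_abs]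
    ring
  simp_rw [e]
  have h2 : Tendsto (fun N => (∫ x, (θ x - Torus.scalarTruncate N θ x) ^ 2) ^ (2 : ℝ)⁻¹) atTop
      (𝓝 0) := by
    have h' := h.rpow_const (p := (2 : ℝ)⁻¹) (Or.inr (by norm_num))
    rwa [Real.zero_rpow (by norm_num)] at h'
  have h3 := ENNReal.tendsto_ofReal h2
  rwa [ENNReal.ofReal_zero] at h3

/-- **Bounded continuous multipliers act boundedly on `L²(𝕋²)`**: for a continuous operator field
`A : 𝕋² → (V →L W)` there is `M` with `‖A b‖_{L²} ≤ M ‖b‖_{L²}` for every field `b`. -/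
theorem exists_eLpNorm_clm_apply_le {V W : Type*} [NormedAddCommGroup V] [InnerProductSpace ℝ V]
    [NormedAddCommGroup W] [NormedSpace ℝ W] {A : UnitAddTorus (Fin 2) → V →L[ℝ] W}
    (hA : Continuous A) :
    ∃ M : ℝ≥0, ∀ b : UnitAddTorus (Fin 2) → V,
      eLpNorm (fun x => A x (b x)) 2 volume ≤ (M : ℝ≥0∞) * eLpNorm b 2 volume := by
  obtain ⟨C, hC⟩ := exists_forall_norm_le_of_continuous hA
  refine ⟨⟨max C 0, le_max_right _ _⟩, fun b => ?_⟩
  have h := eLpNorm_clm_apply_le (μ := volume) (A := A) (b := b) (M := ⟨max C 0, le_max_right _ _⟩)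
    (ae_of_all _ fun x => (hC x).trans (le_max_left _ _)) 2
  rwa [ENNReal.smul_def, smul_eq_mul] at h

/-- **Bounded continuous multipliers preserve `L²` limits**: for a continuous operator field
`A : 𝕋² → (V →L W)` and `bₙ → b₀` in `L²(𝕋²; V)` with `b₀ ∈ L²`, the field `A b₀` is in `L²` and
`A bₙ → A b₀` in `L²`. -/
theorem memLp_and_tendsto_clm_apply {V W : Type*} [NormedAddCommGroup V] [InnerProductSpace ℝ V]
    [NormedAddCommGroup W] [NormedSpace ℝ W] {A : UnitAddTorus (Fin 2) → V →L[ℝ] W}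
    (hA : Continuous A) {b : ℕ → UnitAddTorus (Fin 2) → V} {b₀ : UnitAddTorus (Fin 2) → V}
    (hb₀ : MemLp b₀ 2 volume) (hbl : Tendsto (fun n => eLpNorm (b n - b₀) 2 volume) atTop (𝓝 0)) :
    MemLp (fun x => A x (b₀ x)) 2 volume ∧
      Tendsto (fun n => eLpNorm ((fun x => A x (b n x)) - fun x => A x (b₀ x)) 2 volume)
        atTop (𝓝 0) := by
  obtain ⟨M, hM⟩ := exists_eLpNorm_clm_apply_le hA
  refine ⟨⟨aestronglyMeasurable_clm_apply hA.aestronglyMeasurable hb₀.1,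
    (hM b₀).trans_lt (ENNReal.mul_lt_top ENNReal.coe_lt_top hb₀.2)⟩, ?_⟩
  have hle : ∀ n, eLpNorm ((fun x => A x (b n x)) - fun x => A x (b₀ x)) 2 volume ≤
      M * eLpNorm (b n - b₀) 2 volume := by
    intro n
    have e : ((fun x => A x (b n x)) - fun x => A x (b₀ x)) = fun x => A x ((b n - b₀) x) := by
      funext x; simp only [Pi.sub_apply, map_sub]
    rw [e]
    exact hM _
  have h0 : Tendsto (fun n => (M : ℝ≥0∞) * eLpNorm (b n - b₀) 2 volume) atTop (𝓝 0) := by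
    have h := ENNReal.Tendsto.const_mul hbl (Or.inr ENNReal.coe_ne_top) (a := (M : ℝ≥0∞))
    rwa [mul_zero] at h
  exact tendsto_of_tendsto_of_tendsto_of_le_of_le tendsto_const_nhds h0 (fun _ => bot_le) hle

end Helpers

/-! ## The stub -/

/-- **S6-co/N `stub_weakVorticityNonlinear` — the nonlinear term of Navier–Stokes tested against a
perpendicular gradient is the vorticity transport term.** For `w ∈ L²(𝕋²; ℝ²)` weakly divergence
free, `ω ∈ L²` a weak curl of `w` (`∫(∂₀χ·w₁ - ∂₁χ·w₀) = -∫χω` for smooth `χ`), a smooth `φ` and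
`ψ = ∇^⊥φ = (-∂₁φ, ∂₀φ)`: `∫⟪w, (w·∇)ψ⟫ = -∫ ω ⟪w, ∇φ⟫`. Proof: the smooth identity
`integral_inner_convect_perpGrad_eq` for the divergence-free Fourier truncations `P_N w`, whose
curls are `P_N ω` (`curl_fourierTruncate_eq_scalarTruncate`), and passage to the limit `N → ∞` on
both sides (`P_N w → w`, `P_N ω → ω` in `L²`; the multipliers `Dψ` and `⟪∇φ, ·⟫` are bounded and
continuous). The `H¹` hypothesis is not needed. -/
theorem stub_weakVorticityNonlinear :
    ∀ (w : UnitAddTorus (Fin 2) → EuclideanSpace ℝ (Fin 2)) (ω φ : UnitAddTorus (Fin 2) → ℝ)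
      (ψ : UnitAddTorus (Fin 2) → EuclideanSpace ℝ (Fin 2)),
      MemLp w 2 volume → Torus.eGradNormSq w < ⊤ → Torus.IsWeaklyDivFree w → MemLp ω 2 volume →
      (∀ χ : UnitAddTorus (Fin 2) → ℝ, Torus.IsSmooth χ →
        ∫ x, (Torus.partialDeriv 0 χ x * w x 1 - Torus.partialDeriv 1 χ x * w x 0) = -∫ x, χ x * ω x) →
      Torus.IsSmooth φ → (∀ x, ψ x 0 = -Torus.partialDeriv 1 φ x) → (∀ x, ψ x 1 = Torus.partialDeriv 0 φ x) →
      ∫ x, inner ℝ (w x) (Torus.convect w ψ x) = -∫ x, ω x * inner ℝ (w x) (Torus.gradient φ x) := by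
  intro w ω φ ψ hw _ hdiv hω hcurl hφ h0 h1
  have hwi : Integrable w volume := hw.integrable one_le_two
  have hωi : Integrable ω volume := hω.integrable one_le_two
  have hψ : Torus.IsSmooth ψ := isSmooth_of_eq_perpGrad hφ h0 h1
  have hψ1 : Torus.IsContDiff 1 ψ := hψ.isContDiff (by simp)
  -- the identity for the truncations
  have hN : ∀ N : ℕ,
      ∫ x, ⟪Torus.fourierTruncate N w x, Torus.convect (Torus.fourierTruncate N w) ψ x⟫_ℝ =
        -∫ x, Torus.scalarTruncate N ω x * ⟪Torus.fourierTruncate N w x, Torus.gradient φ x⟫_ℝ := by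
    intro N
    rw [integral_inner_convect_perpGrad_eq (Torus.isSmooth_fourierTruncate N w)
      (Torus.isDivFree_fourierTruncate hw hdiv N) hφ h0 h1]
    congr 1
    refine integral_congr_ae (ae_of_all _ fun x => ?_)
    beta_reduce
    rw [curl_fourierTruncate_eq_scalarTruncate hwi hωi hcurl N x]
  -- `L²` convergences
  have hwl := Torus.tendsto_eLpNorm_fourierTruncate_sub hw
  have hωl := tendsto_eLpNorm_scalarTruncate_sub hω
  obtain ⟨hg₀, hgl⟩ := memLp_and_tendsto_clm_apply (A := Torus.fderiv ψ)
    (b := fun N => Torus.fourierTruncate N w) hψ1.continuous_fderiv hw hwl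
  obtain ⟨hk₀, hkl⟩ := memLp_and_tendsto_clm_apply (A := fun x => innerSL ℝ (Torus.gradient φ x))
    (b := fun N => Torus.fourierTruncate N w)
    ((innerSL ℝ).continuous.comp hφ.gradient.continuous) hw hwl
  -- both sides converge
  have hL : Tendsto (fun N => ∫ x, ⟪Torus.fourierTruncate N w x,
      Torus.convect (Torus.fourierTruncate N w) ψ x⟫_ℝ) atTop
      (𝓝 (∫ x, ⟪w x, Torus.convect w ψ x⟫_ℝ)) :=
    tendsto_integral_inner_of_tendsto_eLpNorm_two_two (f := fun N => Torus.fourierTruncate N w)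
      (g := fun N => Torus.convect (Torus.fourierTruncate N w) ψ)
      (fun N => Torus.memLp_fourierTruncate N w 2)
      (fun N => ((Torus.isSmooth_fourierTruncate N w).convect hψ).memLp 2) hw hg₀ hwl hgl
  have hR : Tendsto (fun N => ∫ x, ⟪Torus.scalarTruncate N ω x,
      ⟪Torus.gradient φ x, Torus.fourierTruncate N w x⟫_ℝ⟫_ℝ) atTop
      (𝓝 (∫ x, ⟪ω x, ⟪Torus.gradient φ x, w x⟫_ℝ⟫_ℝ)) :=
    tendsto_integral_inner_of_tendsto_eLpNorm_two_two (f := fun N => Torus.scalarTruncate N ω)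
      (g := fun N x => ⟪Torus.gradient φ x, Torus.fourierTruncate N w x⟫_ℝ)
      (fun N => Torus.memLp_scalarTruncate N ω 2)
      (fun N => (hφ.gradient.inner (Torus.isSmooth_fourierTruncate N w)).memLp 2) hω hk₀ hωl hkl
  have e : ∀ (a : ℝ) (u v : EuclideanSpace ℝ (Fin 2)), ⟪a, ⟪v, u⟫_ℝ⟫_ℝ = a * ⟪u, v⟫_ℝ := by
    intro a u v
    rw [RCLike.inner_apply, conj_trivial, real_inner_comm u v, mul_comm]
  simp_rw [e] at hR
  have hL' : Tendsto (fun N => ∫ x, ⟪Torus.fourierTruncate N w x,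
      Torus.convect (Torus.fourierTruncate N w) ψ x⟫_ℝ) atTop
      (𝓝 (-∫ x, ω x * ⟪w x, Torus.gradient φ x⟫_ℝ)) := by
    simp_rw [hN]
    exact hR.neg
  exact tendsto_nhds_unique hL hL'

end Summit.AnomalousDissipation.AnomalousDissipation.Theorems.TwohalfdNeg.WeakVorticityNonlinear
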